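import Literature.MathematicalPhysics.QuantumLattice.PairFieldMomentum
import Literature.MathematicalPhysics.QuantumLattice.HubbardRingPerronFrobeniusProofs
import Literature.MathematicalPhysics.QuantumLattice.HubbardWave0RayleighProofs

/-!
# Crux `WindowGap` (stmt-HubbardSuperconductivity-1088), negative side: PAIR-FREE CONFIGURATIONS
# (support for `PenaltySaturation.lean`, target (T2) of `Cruxes/WindowGap/NOTES.md` §6; lead c3)

Occupation-basis bookkeeping for the penalty-saturation negative of crux `KacWindowPenalty.WindowGap`.
A Fock vector supported on ONE configuration `A↑ ∪ B↓` (`pairSet A B`) with `#A = #B = n` lies in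
`szSector (2n) 0` (`mem_szSector_of_supported`); if no site of `A` equals or is a unit step away from a
site of `B` ("pair-free"), every local singlet pair annihilator `P_x = localPair g L x` kills it, hence
so do every momentum-resolved pair field `Δ_g(m) = pairFieldAt g L m` and the Kac-window penalty
`W_ε = L⁻² Σ_{|q_m| ≤ ε} Δ_g(m)ᴴ Δ_g(m)` (`kacWindow_mulVec_eq_zero_of_supported`); if `A`, `B` are
disjoint its Hubbard energy `⟨ψ, hubbardTorus 2 L t U ψ⟩` is `0`
(`star_dotProduct_hubbardTorus_mulVec_eq_zero_of_supported`: hopping terms change the configuration,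
no double occupancy). Geometry (`exists_pairFree_sets`): for `n ≤ (L/2 - 1)·L` such disjoint pair-free
`A`, `B` of size `n` exist — `A` in the rows `< L/2 - 1`, `B` in the rows `L/2 … L-2`, the rows
`L/2 - 1` and `L - 1` separating the two bands on the torus (`pairFree_of_rows`, row arithmetic
`exists_val_add_proj_apply_zero` modulo `L`).

No definitions, no named facts; `--supports stmt-HubbardSuperconductivity-1088`.
Sources: E. H. Lieb, PRL 62 (1989) 1201 (the `(n,n)` configuration sectors); H. Tasaki, Physics and
Mathematics of Quantum Many-Body Systems (2020) §9.2 (occupation basis, Jordan–Wigner operators);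
D. J. Scalapino, Phys. Rep. 250 (1995) 329 §2 (local singlet pair field). Folklore finite-dimensional
statements. Tree search: `RayleighBound.annihilation_mul_annihilation_mulVec_apply`,
`LiebThm1.creation_mul_annihilation_mulVec_apply`, `numberAt_eq_diagonal`, `pairSet`,
`orb_zero_mem_pairSet`, `mem_szSector_two_mul_zero_iff`, `pairFieldAt_def`; Mathlib `Matrix.sum_mulVec`,
`ZMod.intCast_eq_intCast_iff_dvd_sub`, `ZMod.natCast_zmod_val`, `Finset.exists_subset_card_eq`,
`Finset.card_image_of_injective`.
-/

-- the mandated namespace repeats `HubbardSuperconductivity` (single-problem summit, D-0017)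
set_option linter.dupNamespace false

noncomputable section

namespace Summit.HubbardSuperconductivity.HubbardSuperconductivity.Theorems.WindowGap.Negative

open Matrix Finset Literature.MathematicalPhysics.QuantumLattice Literature.Probability.LatticeModels
open scoped ComplexOrder ComplexConjugate

/-! ### States supported on one occupation configuration -/

section Fock

variable {ι : Type*} [LinearOrder ι] [Fintype ι]

/-- A unit vector supported on the single configuration `S` exists (the basis vector `|S⟩`).
Tasaki (2020) §9.2. [folklore] -/
theorem exists_unit_supported_single (S : Finset ι) :
    ∃ ψ : Fock ι, (∀ s, s ≠ S → ψ s = 0) ∧ star ψ ⬝ᵥ ψ = 1 := by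
  classical
  refine ⟨fun s => if s = S then 1 else 0, fun s hs => if_neg hs, ?_⟩
  simp only [dotProduct, Pi.star_apply]
  rw [Finset.sum_eq_single S]
  · simp
  · intro s _ hs
    rw [if_neg hs, mul_zero]
  · intro h
    exact absurd (Finset.mem_univ S) h

/-- A product of two annihilators kills a vector supported on `S` unless BOTH orbitals are occupied
in `S`: `¬(i ∈ S ∧ j ∈ S) → c_i c_j ψ = 0`. Tasaki (2020) §9.2. [folklore] -/
theorem annihilation_mul_annihilation_mulVec_eq_zero_of_supported {S : Finset ι} {ψ : Fock ι}
    (hψ : ∀ s, s ≠ S → ψ s = 0) {i j : ι} (h : ¬(i ∈ S ∧ j ∈ S)) :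
    (annihilation i * annihilation j) *ᵥ ψ = 0 := by
  funext s
  rw [RayleighBound.annihilation_mul_annihilation_mulVec_apply, Pi.zero_apply]
  split_ifs with hc
  · rw [hψ _ ?_, mul_zero]
    intro heq
    apply h
    rw [← heq]
    exact ⟨Finset.mem_insert_of_mem (Finset.mem_insert_self i s), Finset.mem_insert_self j _⟩
  · rfl

/-- The hopping expectation vanishes on a vector supported on one configuration: for `i ≠ j`,
`⟨ψ, c†_i c_j ψ⟩ = 0` (the hop changes the configuration). Tasaki (2020) §9.2. [folklore] -/
theorem star_dotProduct_creation_mul_annihilation_mulVec_eq_zero_of_supported {S : Finset ι}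
    {ψ : Fock ι} (hψ : ∀ s, s ≠ S → ψ s = 0) {i j : ι} (hij : i ≠ j) :
    star ψ ⬝ᵥ ((creation i * annihilation j) *ᵥ ψ) = 0 := by
  simp only [dotProduct, Pi.star_apply]
  refine Finset.sum_eq_zero fun s _ => ?_
  by_cases hs : s = S
  · rw [LiebThm1.creation_mul_annihilation_mulVec_apply]
    split_ifs with hc
    · rw [hψ (insert j (s.erase i)) ?_, mul_zero, mul_zero]
      intro heq
      have hi : i ∈ insert j (s.erase i) := by rw [heq, ← hs]; exact hc.1
      rcases Finset.mem_insert.1 hi with h | h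
      · exact hij h
      · exact Finset.notMem_erase i s h
    · rw [mul_zero]
  · rw [hψ s hs, star_zero, zero_mul]

end Fock

section Orb

variable {Λ : Type*} [LinearOrder Λ] [Fintype Λ]

/-- The number operator is diagonal in the occupation basis: `(n_{xσ} ψ)(s) = [xσ ∈ s] ψ(s)`.
Tasaki (2020) §9.2. [folklore] -/
theorem numberOp_mulVec_apply' (x : Λ) (σ : Fin 2) (ψ : Fock (Orb Λ)) (s : Finset (Orb Λ)) :
    ((numberOp x σ : Matrix (Finset (Orb Λ)) (Finset (Orb Λ)) ℂ) *ᵥ ψ) s =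
      (if orb x σ ∈ s then 1 else 0) * ψ s := by
  rw [← numberAt_orb, numberAt_eq_diagonal, mulVec_diagonal]

/-- No double occupancy at `x` in `S` ⇒ `n_{x↑} n_{x↓} ψ = 0` for `ψ` supported on `S`.
Lieb, PRL 62 (1989) 1201. [folklore] -/
theorem numberOp_mul_numberOp_mulVec_eq_zero_of_supported {S : Finset (Orb Λ)} {ψ : Fock (Orb Λ)}
    (hψ : ∀ s, s ≠ S → ψ s = 0) {x : Λ} (hx : ¬(orb x 0 ∈ S ∧ orb x 1 ∈ S)) :
    ((numberOp x 0 * numberOp x 1 : Matrix (Finset (Orb Λ)) (Finset (Orb Λ)) ℂ)) *ᵥ ψ = 0 := by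
  funext s
  rw [← mulVec_mulVec, numberOp_mulVec_apply', numberOp_mulVec_apply', Pi.zero_apply]
  by_cases hs : s = S
  · subst hs
    by_cases h0 : orb x 0 ∈ s
    · have h1 : orb x 1 ∉ s := fun h1 => hx ⟨h0, h1⟩
      rw [if_neg h1, zero_mul, mul_zero]
    · rw [if_neg h0, zero_mul]
  · rw [hψ s hs, mul_zero, mul_zero]

/-- A vector supported on a configuration with `n` up and `n` down electrons lies in the sector
`szSector (2n) 0`. Lieb, PRL 62 (1989) 1201. [folklore] -/
theorem mem_szSector_of_supported {S : Finset (Orb Λ)} {ψ : Fock (Orb Λ)}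
    (hψ : ∀ s, s ≠ S → ψ s = 0) {n : ℕ} (hup : (upPart S).card = n) (hdn : (downPart S).card = n) :
    ψ ∈ szSector (Λ := Λ) (2 * n) 0 := by
  rw [mem_szSector_two_mul_zero_iff]
  intro s hs
  refine hψ s ?_
  rintro rfl
  exact hs ⟨hup, hdn⟩

end Orb

/-! ### Pair-free configurations on the torus -/

section Torus

variable {L : ℕ} [NeZero L]

/-- **Pair-free configurations.** If no `↑`-site of `A` coincides with or is a unit step away from a
`↓`-site of `B` (in either order along the steps `e ∈ {0, ±e₁, ±e₂}` used by `localPair`), then every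
local singlet pair annihilator kills every vector supported on `A↑ ∪ B↓`: `P_x ψ = 0` for every `x`
and every form factor `g`. Scalapino (1995) §2 eq. (2.2). [folklore] -/
theorem localPair_mulVec_eq_zero_of_supported (g : Site 2 → ℝ) {A B : Finset (FermionTorus 2 L)}
    (hsep : ∀ (x : TorusSite 2 L), ∀ e ∈ insert (0 : Site 2) unitSteps,
      ¬(FermionTorus.ofTorusSite x ∈ A ∧ FermionTorus.ofTorusSite (x + Torus.proj L e) ∈ B) ∧
      ¬(FermionTorus.ofTorusSite x ∈ B ∧ FermionTorus.ofTorusSite (x + Torus.proj L e) ∈ A))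
    {ψ : Fock (Orb (FermionTorus 2 L))} (hψ : ∀ s, s ≠ pairSet A B → ψ s = 0)
    (x : TorusSite 2 L) : localPair g L x *ᵥ ψ = 0 := by
  unfold localPair
  rw [Matrix.sum_mulVec]
  refine Finset.sum_eq_zero fun e he => ?_
  obtain ⟨h1, h2⟩ := hsep x e he
  rw [Matrix.smul_mulVec, sub_mulVec, annihilation_mul_annihilation_mulVec_eq_zero_of_supported hψ,
    annihilation_mul_annihilation_mulVec_eq_zero_of_supported hψ, sub_zero, smul_zero]
  · rwa [orb_one_mem_pairSet, orb_zero_mem_pairSet]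
  · rwa [orb_zero_mem_pairSet, orb_one_mem_pairSet]

/-- Hence every momentum-resolved pair field kills such a vector: `Δ_g(m) ψ = 0`.
Kennedy–Lieb–Shastry (1988) (Fourier modes). [folklore] -/
theorem pairFieldAt_mulVec_eq_zero_of_supported (g : Site 2 → ℝ) {A B : Finset (FermionTorus 2 L)}
    (hsep : ∀ (x : TorusSite 2 L), ∀ e ∈ insert (0 : Site 2) unitSteps,
      ¬(FermionTorus.ofTorusSite x ∈ A ∧ FermionTorus.ofTorusSite (x + Torus.proj L e) ∈ B) ∧
      ¬(FermionTorus.ofTorusSite x ∈ B ∧ FermionTorus.ofTorusSite (x + Torus.proj L e) ∈ A))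
    {ψ : Fock (Orb (FermionTorus 2 L))} (hψ : ∀ s, s ≠ pairSet A B → ψ s = 0)
    (m : TorusSite 2 L) : pairFieldAt g L m *ᵥ ψ = 0 := by
  rw [pairFieldAt_def, Matrix.sum_mulVec]
  refine Finset.sum_eq_zero fun x _ => ?_
  rw [Matrix.smul_mulVec, localPair_mulVec_eq_zero_of_supported g hsep hψ x, smul_zero]

/-- **The Kac-window penalty kills pair-free configurations**: for every window radius `ε` (the
literal window sum of route `KacWindowPenalty`), `W_ε ψ = 0`. [folklore] -/
theorem kacWindow_mulVec_eq_zero_of_supported (g : Site 2 → ℝ) (ε : ℝ)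
    {A B : Finset (FermionTorus 2 L)}
    (hsep : ∀ (x : TorusSite 2 L), ∀ e ∈ insert (0 : Site 2) unitSteps,
      ¬(FermionTorus.ofTorusSite x ∈ A ∧ FermionTorus.ofTorusSite (x + Torus.proj L e) ∈ B) ∧
      ¬(FermionTorus.ofTorusSite x ∈ B ∧ FermionTorus.ofTorusSite (x + Torus.proj L e) ∈ A))
    {ψ : Fock (Orb (FermionTorus 2 L))} (hψ : ∀ s, s ≠ pairSet A B → ψ s = 0) :
    (∑ m : Fin 2 → ZMod L,
        if (2 * Real.pi / (L : ℝ)) ^ 2 * (∑ i : Fin 2, (((m i).valMinAbs : ℤ) : ℝ) ^ 2) ≤ ε ^ 2 then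
          ((L : ℂ) ^ 2)⁻¹ • (Matrix.conjTranspose (pairFieldAt g L m) * pairFieldAt g L m)
        else 0) *ᵥ ψ = 0 := by
  rw [Matrix.sum_mulVec]
  refine Finset.sum_eq_zero fun m _ => ?_
  split_ifs
  · rw [Matrix.smul_mulVec, ← mulVec_mulVec, pairFieldAt_mulVec_eq_zero_of_supported g hsep hψ m,
      mulVec_zero, smul_zero]
  · rw [zero_mulVec]

omit [NeZero L] in
/-- **Zero Hubbard energy without double occupancy**: for disjoint `A`, `B` and `ψ` supported on
`A↑ ∪ B↓`, `⟨ψ, hubbardTorus 2 L t U ψ⟩ = 0` (every hopping term changes the configuration; no site is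
doubly occupied). Lieb, PRL 62 (1989) 1201. [folklore] -/
theorem star_dotProduct_hubbardTorus_mulVec_eq_zero_of_supported (t U : ℝ)
    {A B : Finset (FermionTorus 2 L)} (hAB : Disjoint A B)
    {ψ : Fock (Orb (FermionTorus 2 L))} (hψ : ∀ s, s ≠ pairSet A B → ψ s = 0) :
    star ψ ⬝ᵥ (hubbardTorus 2 L t U *ᵥ ψ) = 0 := by
  have hH : hubbardTorus 2 L t U =
      -(t : ℂ) • (∑ x : FermionTorus 2 L, ∑ y : FermionTorus 2 L, ∑ σ : Fin 2,
        if (fermionTorusGraph 2 L).Adj x y then creation (orb x σ) * annihilation (orb y σ) else 0) +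
      (U : ℂ) • ∑ x : FermionTorus 2 L, numberOp x 0 * numberOp x 1 := rfl
  have hhop : ∀ (x y : FermionTorus 2 L) (σ : Fin 2),
      star ψ ⬝ᵥ ((if (fermionTorusGraph 2 L).Adj x y then
          creation (orb x σ) * annihilation (orb y σ) else
            (0 : Matrix (Finset (Orb (FermionTorus 2 L))) (Finset (Orb (FermionTorus 2 L))) ℂ)) *ᵥ
              ψ) = 0 := by
    intro x y σ
    by_cases hadj : (fermionTorusGraph 2 L).Adj x y
    · rw [if_pos hadj]
      have hxy : x ≠ y := (fermionTorusGraph 2 L).ne_of_adj hadj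
      exact star_dotProduct_creation_mul_annihilation_mulVec_eq_zero_of_supported hψ
        (fun h => hxy (orb_inj.1 h).1)
    · rw [if_neg hadj, zero_mulVec, dotProduct_zero]
  have hint : ∀ x : FermionTorus 2 L,
      ((numberOp x 0 * numberOp x 1 :
        Matrix (Finset (Orb (FermionTorus 2 L))) (Finset (Orb (FermionTorus 2 L))) ℂ)) *ᵥ ψ = 0 := by
    intro x
    refine numberOp_mul_numberOp_mulVec_eq_zero_of_supported hψ ?_
    rw [orb_zero_mem_pairSet, orb_one_mem_pairSet]
    exact fun h => Finset.disjoint_left.1 hAB h.1 h.2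
  have hhopSum : ∑ x : FermionTorus 2 L, star ψ ⬝ᵥ ((∑ y : FermionTorus 2 L, ∑ σ : Fin 2,
      (if (fermionTorusGraph 2 L).Adj x y then creation (orb x σ) * annihilation (orb y σ) else
        (0 : Matrix (Finset (Orb (FermionTorus 2 L))) (Finset (Orb (FermionTorus 2 L))) ℂ))) *ᵥ
          ψ) = 0 := by
    refine Finset.sum_eq_zero fun x _ => ?_
    rw [Matrix.sum_mulVec, dotProduct_sum]
    refine Finset.sum_eq_zero fun y _ => ?_
    rw [Matrix.sum_mulVec, dotProduct_sum]
    exact Finset.sum_eq_zero fun σ _ => hhop x y σ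
  have hintSum : ∑ x : FermionTorus 2 L, star ψ ⬝ᵥ (((numberOp x 0 * numberOp x 1 :
      Matrix (Finset (Orb (FermionTorus 2 L))) (Finset (Orb (FermionTorus 2 L))) ℂ)) *ᵥ ψ) = 0 :=
    Finset.sum_eq_zero fun x _ => by rw [hint x, dotProduct_zero]
  rw [hH, add_mulVec, Matrix.smul_mulVec, Matrix.smul_mulVec, dotProduct_add, dotProduct_smul,
    dotProduct_smul, Matrix.sum_mulVec, dotProduct_sum, Matrix.sum_mulVec, dotProduct_sum,
    hhopSum, hintSum, smul_zero, smul_zero, add_zero]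

/-! ### Geometry: two bands of rows at graph distance `≥ 2` -/

omit [NeZero L] in
/-- The steps entering `localPair` change the row index by `0` or `±1`: `e 0 ∈ {0, 1, -1}` for
`e ∈ {0, ±e₁, ±e₂}`. [folklore] -/
theorem apply_zero_of_mem_insert_unitSteps {e : Site 2} (he : e ∈ insert (0 : Site 2) unitSteps) :
    e 0 = 0 ∨ e 0 = 1 ∨ e 0 = -1 := by
  simp only [unitSteps, Finset.mem_insert, Finset.mem_singleton] at he
  rcases he with rfl | rfl | rfl | rfl | rfl
  · exact Or.inl rfl
  · exact Or.inr (Or.inl (by simp))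
  · exact Or.inr (Or.inr (by simp))
  · exact Or.inl (by simp)
  · exact Or.inl (by simp)

/-- Row arithmetic on the torus: the canonical representative of the first coordinate of `x + e`
is `(x 0).val + e 0` up to a multiple of `L`. [folklore] -/
theorem exists_val_add_proj_apply_zero (x : TorusSite 2 L) (e : Site 2) :
    ∃ k : ℤ, (((x + Torus.proj L e) 0).val : ℤ) = ((x 0).val : ℤ) + e 0 + (L : ℤ) * k := by
  have h1 : ((((x + Torus.proj L e) 0).val : ℤ) : ZMod L) = ((((x 0).val : ℤ) + e 0 : ℤ) : ZMod L) := by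
    push_cast
    rw [ZMod.natCast_zmod_val, ZMod.natCast_zmod_val, Pi.add_apply, Torus.proj_apply]
  rw [ZMod.intCast_eq_intCast_iff_dvd_sub] at h1
  obtain ⟨k, hk⟩ := h1
  exact ⟨-k, by linarith⟩

omit [NeZero L] in
/-- A multiple of `L` in `[-L, L]` is `-L`, `0` or `L`. [folklore] -/
theorem int_mul_eq_cases {k : ℤ} (hL : 0 < (L : ℤ)) (h1 : (L : ℤ) * k ≤ L) (h2 : -(L : ℤ) ≤ L * k) :
    k = -1 ∨ k = 0 ∨ k = 1 := by
  have hk1 : k ≤ 1 := Int.le_of_mul_le_mul_left (by linarith) hL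
  have hk2 : -1 ≤ k := Int.le_of_mul_le_mul_left (by linarith) hL
  omega

/-- **Two bands of rows are pair-free.** If every site of `A` lies in a row `< h` and every site of
`B` in a row `r` with `h < r` and `r + 1 < L` (so rows `h` and `L - 1` separate the bands on the
torus), then no site of `A` equals or is a unit step away from a site of `B`, in either order.
[folklore] -/
theorem pairFree_of_rows {h : ℕ} (hh : h < L) {A B : Finset (FermionTorus 2 L)}
    (hA : ∀ y ∈ A, (ofLex y 0 : ℕ) < h)
    (hB : ∀ y ∈ B, h < (ofLex y 0 : ℕ) ∧ (ofLex y 0 : ℕ) + 1 < L) :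
    ∀ (x : TorusSite 2 L), ∀ e ∈ insert (0 : Site 2) unitSteps,
      ¬(FermionTorus.ofTorusSite x ∈ A ∧ FermionTorus.ofTorusSite (x + Torus.proj L e) ∈ B) ∧
      ¬(FermionTorus.ofTorusSite x ∈ B ∧ FermionTorus.ofTorusSite (x + Torus.proj L e) ∈ A) := by
  intro x e he
  obtain ⟨k, hk⟩ := exists_val_add_proj_apply_zero x e
  have hr : ((x 0).val : ℤ) < L := by exact_mod_cast ZMod.val_lt (x 0)
  have hr' : (((x + Torus.proj L e) 0).val : ℤ) < L := by exact_mod_cast ZMod.val_lt _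
  have hr0 : (0 : ℤ) ≤ ((x 0).val : ℤ) := by positivity
  have hr0' : (0 : ℤ) ≤ (((x + Torus.proj L e) 0).val : ℤ) := by positivity
  have hLpos : (0 : ℤ) < L := by exact_mod_cast Nat.pos_of_ne_zero (NeZero.ne L)
  have he0 := apply_zero_of_mem_insert_unitSteps he
  have hk' : k = -1 ∨ k = 0 ∨ k = 1 := by
    refine int_mul_eq_cases hLpos ?_ ?_ <;> rcases he0 with h0 | h0 | h0 <;> rw [h0] at hk <;> linarith
  have hrow : ∀ z : TorusSite 2 L, (ofLex (FermionTorus.ofTorusSite z) 0 : ℕ) = (z 0).val :=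
    fun z => FermionTorus.ofLex_ofTorusSite_apply z 0
  have hhL : (h : ℤ) < L := by exact_mod_cast hh
  constructor
  · rintro ⟨hxA, hxB⟩
    have h1 := hA _ hxA
    obtain ⟨h2, h3⟩ := hB _ hxB
    rw [hrow] at h1 h2 h3
    zify at h1 h2 h3
    rcases he0 with h0 | h0 | h0 <;> rw [h0] at hk <;> rcases hk' with rfl | rfl | rfl <;> omega
  · rintro ⟨hxB, hxA⟩
    have h1 := hA _ hxA
    obtain ⟨h2, h3⟩ := hB _ hxB
    rw [hrow] at h1 h2 h3
    zify at h1 h2 h3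
    rcases he0 with h0 | h0 | h0 <;> rw [h0] at hk <;> rcases hk' with rfl | rfl | rfl <;> omega

omit [NeZero L] in
/-- The band of rows `< h` holds at least `h·L` sites (`h ≤ L`). [folklore] -/
theorem mul_le_card_filter_row_lt {h : ℕ} (hh : h ≤ L) :
    h * L ≤ (univ.filter fun y : FermionTorus 2 L => (ofLex y 0 : ℕ) < h).card := by
  let f : Fin h × Fin L → FermionTorus 2 L := fun p => toLex ![Fin.castLE hh p.1, p.2]
  have hf : Function.Injective f := by
    rintro ⟨a, b⟩ ⟨a', b'⟩ hab
    have hv : ![Fin.castLE hh a, b] = ![Fin.castLE hh a', b'] := toLex.injective hab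
    have h0 := congrFun hv 0
    have h1 := congrFun hv 1
    simp only [Matrix.cons_val_zero, Matrix.cons_val_one] at h0 h1
    simp only [Prod.mk.injEq]
    exact ⟨Fin.castLE_injective hh h0, h1⟩
  have hsub : (univ.image f) ⊆ univ.filter fun y : FermionTorus 2 L => (ofLex y 0 : ℕ) < h := by
    intro y hy
    obtain ⟨p, -, rfl⟩ := Finset.mem_image.1 hy
    simp only [Finset.mem_filter, Finset.mem_univ, true_and, f, ofLex_toLex, Matrix.cons_val_zero,
      Fin.val_castLE]
    exact p.1.isLt
  calc h * L = (univ.image f).card := by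
        rw [Finset.card_image_of_injective _ hf, Finset.card_univ, Fintype.card_prod,
          Fintype.card_fin, Fintype.card_fin]
    _ ≤ _ := Finset.card_le_card hsub

omit [NeZero L] in
/-- The band of rows `h+1 … 2h` holds at least `h·L` sites (`2h + 2 ≤ L`), and its rows `r` satisfy
`h < r`, `r + 1 < L`. [folklore] -/
theorem mul_le_card_filter_row_mid {h : ℕ} (hh : 2 * h + 2 ≤ L) :
    h * L ≤ (univ.filter fun y : FermionTorus 2 L =>
      h < (ofLex y 0 : ℕ) ∧ (ofLex y 0 : ℕ) + 1 < L).card := by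
  let f : Fin h × Fin L → FermionTorus 2 L :=
    fun p => toLex ![⟨h + 1 + p.1, by omega⟩, p.2]
  have hf : Function.Injective f := by
    rintro ⟨a, b⟩ ⟨a', b'⟩ hab
    have hv := toLex.injective hab
    have h0 := congrFun hv 0
    have h1 := congrFun hv 1
    simp only [Matrix.cons_val_zero, Matrix.cons_val_one, Fin.mk.injEq] at h0 h1
    simp only [Prod.mk.injEq]
    exact ⟨Fin.ext (by omega), h1⟩
  have hsub : (univ.image f) ⊆ univ.filter fun y : FermionTorus 2 L =>
      h < (ofLex y 0 : ℕ) ∧ (ofLex y 0 : ℕ) + 1 < L := by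
    intro y hy
    obtain ⟨p, -, rfl⟩ := Finset.mem_image.1 hy
    simp only [Finset.mem_filter, Finset.mem_univ, true_and, f, ofLex_toLex, Matrix.cons_val_zero]
    constructor <;> omega
  calc h * L = (univ.image f).card := by
        rw [Finset.card_image_of_injective _ hf, Finset.card_univ, Fintype.card_prod,
          Fintype.card_fin, Fintype.card_fin]
    _ ≤ _ := Finset.card_le_card hsub

omit [NeZero L] in
/-- **Pair-free sets of prescribed size.** For `n ≤ (L/2 - 1)·L` there are disjoint `A`, `B` with
`#A = #B = n` such that no site of `A` equals or neighbours (along `{0, ±e₁, ±e₂}`) a site of `B`: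
`A` in the rows `< L/2 - 1`, `B` in the rows `L/2 … L - 2`. [folklore] -/
theorem exists_pairFree_sets [NeZero L] {n : ℕ} (hn : n ≤ (L / 2 - 1) * L) :
    ∃ A B : Finset (FermionTorus 2 L), A.card = n ∧ B.card = n ∧ Disjoint A B ∧
      ∀ (x : TorusSite 2 L), ∀ e ∈ insert (0 : Site 2) unitSteps,
        ¬(FermionTorus.ofTorusSite x ∈ A ∧ FermionTorus.ofTorusSite (x + Torus.proj L e) ∈ B) ∧
        ¬(FermionTorus.ofTorusSite x ∈ B ∧ FermionTorus.ofTorusSite (x + Torus.proj L e) ∈ A) := by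
  rcases Nat.eq_zero_or_pos n with rfl | hnpos
  · refine ⟨∅, ∅, rfl, rfl, disjoint_bot_left, fun x e _ => ⟨?_, ?_⟩⟩ <;> simp
  set h := L / 2 - 1 with hhdef
  have hhL : 1 ≤ h := by
    by_contra h0
    push Not at h0
    have : h = 0 := by omega
    rw [this, zero_mul] at hn
    omega
  have h2 : 2 * h + 2 ≤ L := by omega
  have h1 : h ≤ L := by omega
  obtain ⟨A, hAsub, hAcard⟩ := Finset.exists_subset_card_eq (hn.trans (mul_le_card_filter_row_lt h1))
  obtain ⟨B, hBsub, hBcard⟩ := Finset.exists_subset_card_eq (hn.trans (mul_le_card_filter_row_mid h2))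
  have hA : ∀ y ∈ A, (ofLex y 0 : ℕ) < h := fun y hy => (Finset.mem_filter.1 (hAsub hy)).2
  have hB : ∀ y ∈ B, h < (ofLex y 0 : ℕ) ∧ (ofLex y 0 : ℕ) + 1 < L :=
    fun y hy => (Finset.mem_filter.1 (hBsub hy)).2
  refine ⟨A, B, hAcard, hBcard, ?_, pairFree_of_rows (by omega) hA hB⟩
  rw [Finset.disjoint_left]
  intro y hyA hyB
  have := hA y hyA
  have := (hB y hyB).1
  omega

end Torus

end Summit.HubbardSuperconductivity.HubbardSuperconductivity.Theorems.WindowGap.Negative
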